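import Summits.PneNP.PneNP.Theses.BavardGap

/-!
# Refutation of `BavardGap.PlantedGenusPseudorandom` (stmt-PneNP-2493)

The crux demands, for EVERY `n : ℕ`, a planted ensemble `PL n : PMF (List Bool)` supported on
codes of reduced balanced words `w` of length `2n` that carry a letter/inverse-letter pairing `π`
with `|w|/2 + 1 ≤ 2·(θ + θ/q) + #cycles((finRotate |w|).trans π)`. At `n = 0` the only word is
the empty word, the only pairing is the empty permutation, `θ(0) = 0` and `#cycles = 0`, so the
inequality reads `1 ≤ 0`: no admissible word exists, while a `PMF` always has non-empty support.
(The same happens at `n = 1`: no reduced balanced word of length 2.) Hence the statement is false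
as written; the intended statement needs the support condition only for large `n`
(`∀ᶠ n in atTop` / `n ≥ 2`). Witness: `q = 1`, `n = 0`. [folklore]
-/

namespace Summit.PneNP.PneNP.Theses.BavardGap

open scoped BigOperators Topology Manifold Classical MeasureTheory ProbabilityTheory Matrix InnerProductSpace ComplexConjugate ContinuousMap
open Filter Set Function TopologicalSpace MeasureTheory

/-- **Record of the replaced/dropped route item `PlantedGenusPseudorandom`** = stmt-PneNP-2493 (ledger signature verbatim, in
the route file's namespace and `open` context; NOT a route item): after `BavardGapPlantedGenusPseudorandom_refuted` (below) closed the
item `refuted` at effcd627efb9, the route repair (`restate` under a new name, or `drop`) removed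
this constant from the gate-written Theses file, while the Theorems file below — append-only,
statement text fixed — still names it ("Unknown identifier" in the full builds of 2026-08-16).
Re-declared here under its original fully-qualified name and definiens solely so that this record
keeps elaborating. FALSE (refuted below). -/
def PlantedGenusPseudorandom : Prop :=
  ∀ q : ℕ, 0 < q → ∃ PL : ℕ → PMF (List Bool), (∃ S : Literature.Computability.Complexity.RandAlg ℕ (List Bool), S.IsPolyTime Computability.unaryEncodeNat id ∧ ∀ n : ℕ, S.outputPMF Computability.unaryEncodeNat n = PL n) ∧ (∀ n : ℕ, ∀ x ∈ (PL n).support, ∃ w : Fin (2 * n) → Fin 2 × Bool, w ∈ (Finset.univ.filter fun w : Fin ((2 * n)) → Fin 2 × Bool => FreeGroup.reduce (List.ofFn w) = List.ofFn w ∧ ∀ a : Fin 2, (Finset.univ.filter fun i => w i = (a, true)).card = (Finset.univ.filter fun i => w i = (a, false)).card) ∧ x = ((List.ofFn w).flatMap fun a => [decide (a.1 = 1), a.2]) ∧ (∃ π : Equiv.Perm (Fin (List.ofFn w).length), (∀ i, π (π i) = i) ∧ (∀ i, π i ≠ i) ∧ (∀ i, (List.ofFn w).get (π i) = (((List.ofFn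 w).get i).1, !((List.ofFn w).get i).2)) ∧ (List.ofFn w).length / 2 + 1 ≤ 2 * (((2 * n)) / (6 * Nat.log 3 ((2 * n))) + ((2 * n)) / (6 * Nat.log 3 ((2 * n))) / q) + (Multiset.card (Equiv.Perm.cycleType ((finRotate (List.ofFn w).length).trans π)) + (Finset.univ.filter fun c => ((finRotate (List.ofFn w).length).trans π) c = c).card))) ∧ ∀ D : Literature.Computability.Complexity.RandAlg (List Bool) Bool, D.IsPolyTime id Computability.encodeBool → ∃ᶠ n in Filter.atTop, |(((PL n).bind fun s => D.outputPMF id (Literature.Computability.Complexity.boolPair (Computability.unaryEncodeNat n) s)) true).toReal - ((((if h : ((Finset.univ.filter fun w : Fin ((2 * n)) → Fin 2 × Bool => FreeGroup.reduce (List.ofFn w) = List.ofFn w ∧ ∀ a : Fin 2, (Finset.univ.filter fun i => w i = (a, true)).card = (Finset.univ.filter fun i => w i = (a, false)).card)).Nonempty then (PMF.uniformOfFinset ((Finset.univ.filter fun w : Fin ((2 * n)) → Fin 2 × Bool => FreeGroup.reduce (List.ofFn w) = List.ofFn w ∧ ∀ a : Fin 2, (Finset.univ.filter fun i => w i = (a,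 true)).card = (Finset.univ.filter fun i => w i = (a, false)).card)) h).map (fun w => ((List.ofFn w).flatMap fun a => [decide (a.1 = 1), a.2])) else PMF.pure [])).bind fun s => D.outputPMF id (Literature.Computability.Complexity.boolPair (Computability.unaryEncodeNat n) s)) true).toReal| < 1 / 4

end Summit.PneNP.PneNP.Theses.BavardGap

namespace Summit.PneNP.PneNP.Theorems

/-- Refutes `BavardGap.PlantedGenusPseudorandom`: at `n = 0` the support condition is
unsatisfiable (empty word, empty pairing: `0/2 + 1 ≤ 2·0 + 0` fails) but `(PL 0).support` is
non-empty; witness `q = 1, n = 0`. [folklore] -/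
theorem BavardGapPlantedGenusPseudorandom_refuted :
    ¬ Summit.PneNP.PneNP.Theses.BavardGap.PlantedGenusPseudorandom := by
  intro h
  obtain ⟨PL, -, hsupp, -⟩ := h 1 Nat.one_pos
  obtain ⟨x, hx⟩ := (PL 0).support_nonempty
  obtain ⟨w, -, -, π, -, -, -, hle⟩ := hsupp 0 x hx
  have hcard : Fintype.card (Fin (List.ofFn w).length) = 0 := by simp
  haveI : IsEmpty (Fin (List.ofFn w).length) := Fintype.card_eq_zero_iff.mp hcard
  have h1 : (finRotate (List.ofFn w).length).trans π = 1 := Subsingleton.elim _ _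
  rw [h1, Equiv.Perm.cycleType_one] at hle
  simp [Finset.univ_eq_empty] at hle

end Summit.PneNP.PneNP.Theorems
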